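import Mathlib.MeasureTheory.Integral.IntervalIntegral.FundThmCalculus
import Literature.Analysis.FunctionSpaces.TorusSpaceTime
import Literature.Analysis.FunctionSpaces.TorusFluidGlueProofs
import Literature.Analysis.FluidPDE.PassiveScalar
import HarnessLib

/-!
# Discharged fact: classical solutions of the passive scalar equation on `T^d` are weak solutions

`Literature.Analysis.FluidPDE.PassiveScalar` records as the named fact
`Torus.IsClassicalScalarTransportOn.isWeakScalarTransportOn` that a classical (jointly smooth)
solution `θ` of the advection–diffusion equation `∂ₜθ + u·∇θ = κΔθ`, `div u = 0`, on a time set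
`S ⊇ [0, T]` is a weak (distributional) solution on `T^d × [0, T)` with datum `θ 0`
(`Torus.IsWeakScalarTransportOn T κ u (θ 0) θ`: the class `θ ∈ L^∞_t L²_x`, `u ∈ L¹_t L²_x`,
`u θ ∈ L¹_{t,x}`, weak incompressibility, and the weak identity
`∫₀ᵀ ∫ θ (∂ₜψ + u·∇ψ + κΔψ) + ∫ θ(0) ψ(0) = 0` against smooth test functions `ψ` vanishing near
`t = T`; DiPerna–Lions 1989, §II.1, (12)–(14): the distributional formulation of linear transport
equations with initial datum, tested against smooth functions compactly supported in
`[0, T) × (space)`, so that the datum enters through the boundary term at `t = 0`; Evans 2010,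
§7.1.1 (b), "Motivation for definition of weak solution" of a parabolic equation: multiply the
equation by a test function and integrate by parts). It is proved here
(`Torus.IsClassicalScalarTransportOn.isWeakScalarTransportOn_holds`), exactly along the printed
remark and in the same way as the Navier–Stokes twin
`Torus.IsClassicalNSSolutionOn.isWeakNSSolutionForcedOn_holds` (`WeakSolutionProofs`):

* `θ` and `u` are continuous on the compact `[0, T] × T^d`, hence measurable on `(0,T) × T^d`
  and bounded, which gives `θ ∈ L^∞_t L²_x`, `u ∈ L¹_t L²_x`, `u θ ∈ L¹_{t,x}`;
* `div u(t) = 0` classically implies weakly (`Torus.IsDivFree.isWeaklyDivFree_holds`);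
* for a test function `ψ`, the pairing `E(t) = ∫ θ(t) ψ(t)` has `E(T) = 0`, is differentiable
  within `[0, T]` with `E'(t) = ∫ ∂ₜ(θψ) = ∫ ((κΔθ - u·∇θ) ψ + θ ∂ₜψ)` (differentiation under the
  integral, `Torus.IsSmoothSpaceTimeOn.hasDerivWithinAt_integral`, and the equation), and the two
  integrations by parts on the torus — Green's second identity `∫ (Δθ) ψ = ∫ θ Δψ`
  (`Torus.integral_mul_laplacian_comm_holds`, Evans App. C.2 Thm. 3) and the transport identity
  `∫ θ (u·∇ψ) + ∫ (u·∇θ) ψ = ∫ D(θψ)[u] = 0` for divergence-free `u`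
  (`Torus.integral_fderiv_apply_eq_zero_of_isDivFree`, Evans App. C.2 Thm. 2) — turn `E'` into
  the weak integrand `∫ θ (∂ₜψ + u·∇ψ + κΔψ)`; finally `∫₀ᵀ E' = E(T) - E(0) = -∫ θ(0) ψ(0)`
  (fundamental theorem of calculus) is the weak identity with datum.

For `T ≤ 0` the time interval is empty and the test functions vanish at `t = 0`, so the identity
is trivial. The statement was found faithful as vendored (not mis-stated).

## References

* R. J. DiPerna, P.-L. Lions, *Ordinary differential equations, transport theory and Sobolev
  spaces*, Invent. Math. 98 (1989), 511–547, §II.1, (12)–(14). [DiPernaLions1989]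
* L. C. Evans, *Partial Differential Equations*, 2nd ed., GSM 19 (2010), §7.1.1 (b)–§7.1.2 (weak
  solutions of parabolic equations; motivation: multiply by a test function and integrate by
  parts), App. C.2, Thms. 2–3 (integration by parts, Green's formulas). [Evans2010]
-/

open MeasureTheory Set Topology Filter
open scoped InnerProductSpace ContDiff ENNReal NNReal

noncomputable section

namespace Literature.Analysis.FluidPDE

namespace Torus

variable {d : Type*} [Fintype d] [DecidableEq d]

/-- **Transport identity against a product.** For a smooth divergence-free vector field `u` and
smooth scalars `θ`, `ψ` on `T^d`, `∫ θ ⟪u, ∇ψ⟫ + ∫ ⟪u, ∇θ⟫ ψ = 0`: the integrand is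
`D(θψ)[u]`, whose integral vanishes (`Torus.integral_fderiv_apply_eq_zero_of_isDivFree`;
Evans, App. C.2, Thm. 2 with empty boundary and `div u = 0`). [cite: Evans2010, App. C.2 Thm. 2] -/
theorem integral_mul_inner_gradient_add_eq_zero {u : UnitAddTorus d → EuclideanSpace ℝ d}
    {θ ψ : UnitAddTorus d → ℝ} (hu : FunctionSpaces.Torus.IsSmooth u) (hdiv : FunctionSpaces.Torus.IsDivFree u) (hθ : FunctionSpaces.Torus.IsSmooth θ)
    (hψ : FunctionSpaces.Torus.IsSmooth ψ) :
    (∫ x, θ x * ⟪u x, FunctionSpaces.Torus.gradient ψ x⟫_ℝ) + ∫ x, ⟪u x, FunctionSpaces.Torus.gradient θ x⟫_ℝ * ψ x = 0 := by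
  have h0 := FunctionSpaces.Torus.integral_fderiv_apply_eq_zero_of_isDivFree hu (hθ.smul' hψ) hdiv
  have hpt : (fun x => FunctionSpaces.Torus.fderiv (fun y => θ y • ψ y) x (u x)) =
      fun x => θ x * ⟪u x, FunctionSpaces.Torus.gradient ψ x⟫_ℝ + ⟪u x, FunctionSpaces.Torus.gradient θ x⟫_ℝ * ψ x := by
    funext x
    rw [FunctionSpaces.Torus.fderiv_smul_apply (hθ.isContDiff (by simp)) (hψ.isContDiff (by simp)),
      ← FunctionSpaces.Torus.inner_gradient_left, ← FunctionSpaces.Torus.inner_gradient_left, real_inner_comm (u x) (FunctionSpaces.Torus.gradient ψ x),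
      real_inner_comm (u x) (FunctionSpaces.Torus.gradient θ x)]
    rfl
  -- (`θ x • f x = θ x * f x` on `ℝ`: the smoothness lemmas are stated with `•`)
  have i1 : Integrable (fun x => θ x * ⟪u x, FunctionSpaces.Torus.gradient ψ x⟫_ℝ) volume :=
    (hθ.smul' (hu.inner hψ.gradient)).integrable
  have i2 : Integrable (fun x => ⟪u x, FunctionSpaces.Torus.gradient θ x⟫_ℝ * ψ x) volume :=
    ((hu.inner hθ.gradient).smul' hψ).integrable
  rw [hpt, integral_add i1 i2] at h0
  exact h0

/-- Discharge of the named fact `Torus.IsClassicalScalarTransportOn.isWeakScalarTransportOn`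
(`PassiveScalar`): a classical solution of `∂ₜθ + u·∇θ = κΔθ`, `div u = 0`, on a time set
`S ⊇ [0, T]` is a weak solution on `T^d × [0, T)` with datum `θ 0` in the sense of
DiPerna–Lions 1989, §II.1, (12)–(14) (multiply the equation by a test function, integrate by
parts on `T^d` — no boundary terms — and in time, the boundary term at `t = 0` being the datum
pairing `∫ θ(0) ψ(0)`; the integrability clauses `θ ∈ L^∞_t L²_x`, `u ∈ L¹_t L²_x`,
`u θ ∈ L¹_{t,x}` hold by continuity on the compact `[0, T] × T^d`; Evans 2010, §7.1.1 (b)). [cite: DiPernaLions1989, §II.1 (12)–(14)] -/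
theorem IsClassicalScalarTransportOn.isWeakScalarTransportOn_holds :
    IsClassicalScalarTransportOn.isWeakScalarTransportOn (d := d) := by
  intro S κ T u θ h hS
  have hu : FunctionSpaces.Torus.IsSmoothSpaceTimeOn S u := h.smooth_velocity
  have hθ : FunctionSpaces.Torus.IsSmoothSpaceTimeOn S θ := h.smooth_scalar
  have hIoo_S : Ioo 0 T ⊆ S := Ioo_subset_Icc_self.trans hS
  -- uniform bounds on the compact `[0, T] × T^d`
  obtain ⟨Cθ, hCθ⟩ := hθ.exists_norm_le_of_isCompact isCompact_Icc hS
  obtain ⟨Cu, hCu⟩ := hu.exists_norm_le_of_isCompact isCompact_Icc hS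
  have hbθ : ∀ t ∈ Ioo 0 T, ∀ x, ‖θ t x‖ₑ ≤ (Cθ.toNNReal : ℝ≥0∞) := fun t ht x => by
    rw [← ofReal_norm]
    exact ENNReal.ofReal_le_ofReal (hCθ t (Ioo_subset_Icc_self ht) x)
  have hbu : ∀ t ∈ Ioo 0 T, ∀ x, ‖u t x‖ₑ ≤ (Cu.toNNReal : ℝ≥0∞) := fun t ht x => by
    rw [← ofReal_norm]
    exact ENNReal.ofReal_le_ofReal (hCu t (Ioo_subset_Icc_self ht) x)
  have hvol : volume (Ioo (0 : ℝ) T) < ⊤ := by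
    rw [Real.volume_Ioo]; exact ENNReal.ofReal_lt_top
  -- `∫ ‖u(t)‖ₑ² ≤ Cu²` on `(0, T)`
  have hu2 : ∀ t ∈ Ioo 0 T, ∫⁻ x, ‖u t x‖ₑ ^ 2 ≤ (Cu.toNNReal : ℝ≥0∞) ^ 2 := fun t ht =>
    calc ∫⁻ x, ‖u t x‖ₑ ^ 2 ≤ ∫⁻ _, (Cu.toNNReal : ℝ≥0∞) ^ 2 :=
          lintegral_mono fun x => by gcongr; exact hbu t ht x
      _ = (Cu.toNNReal : ℝ≥0∞) ^ 2 := by rw [lintegral_const, measure_univ, mul_one]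
  refine ⟨?_, ?_, ?_, ?_, ?_, ?_, ?_⟩
  -- (1)–(2) measurability on `(0,T) × ℝ^d`: the lifts are continuous there
  · exact hθ.aestronglyMeasurable_stLift measurableSet_Ioo hIoo_S
  · exact hu.aestronglyMeasurable_stLift measurableSet_Ioo hIoo_S
  -- (3) `θ ∈ L^∞(0,T; L²)`
  · refine ⟨Cθ.toNNReal ^ 2, (ae_restrict_iff' measurableSet_Ioo).2 (ae_of_all _ fun t ht => ?_)⟩
    calc ∫⁻ x, ‖θ t x‖ₑ ^ 2 ≤ ∫⁻ _, (Cθ.toNNReal : ℝ≥0∞) ^ 2 :=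
          lintegral_mono fun x => by gcongr; exact hbθ t ht x
      _ = ((Cθ.toNNReal ^ 2 : ℝ≥0) : ℝ≥0∞) := by
          rw [lintegral_const, measure_univ, mul_one, ENNReal.coe_pow]
  -- (4) `u ∈ L¹(0,T; L²)`
  · calc ∫⁻ t in Ioo 0 T, (∫⁻ x, ‖u t x‖ₑ ^ 2) ^ (1 / 2 : ℝ)
        ≤ ∫⁻ _ in Ioo 0 T, ((Cu.toNNReal : ℝ≥0∞) ^ 2) ^ (1 / 2 : ℝ) :=
          setLIntegral_mono' measurableSet_Ioo fun t ht =>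
            ENNReal.rpow_le_rpow (hu2 t ht) (by norm_num)
      _ = ((Cu.toNNReal : ℝ≥0∞) ^ 2) ^ (1 / 2 : ℝ) * volume (Ioo (0 : ℝ) T) :=
          setLIntegral_const _ _
      _ < ⊤ := ENNReal.mul_lt_top (ENNReal.rpow_lt_top_of_nonneg (by norm_num)
          (ENNReal.pow_ne_top ENNReal.coe_ne_top)) hvol
  -- (5) `u θ ∈ L¹((0,T) × T^d)`
  · calc ∫⁻ t in Ioo 0 T, ∫⁻ x, ‖u t x‖ₑ * ‖θ t x‖ₑ
        ≤ ∫⁻ _ in Ioo 0 T, (Cu.toNNReal : ℝ≥0∞) * Cθ.toNNReal :=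
          setLIntegral_mono' measurableSet_Ioo fun t ht =>
            calc ∫⁻ x, ‖u t x‖ₑ * ‖θ t x‖ₑ ≤ ∫⁻ _, (Cu.toNNReal : ℝ≥0∞) * Cθ.toNNReal :=
                  lintegral_mono fun x => mul_le_mul' (hbu t ht x) (hbθ t ht x)
              _ = (Cu.toNNReal : ℝ≥0∞) * Cθ.toNNReal := by
                  rw [lintegral_const, measure_univ, mul_one]
      _ = (Cu.toNNReal : ℝ≥0∞) * Cθ.toNNReal * volume (Ioo (0 : ℝ) T) := setLIntegral_const _ _
      _ < ⊤ := ENNReal.mul_lt_top (ENNReal.mul_lt_top ENNReal.coe_lt_top ENNReal.coe_lt_top) hvol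
  -- (6) `u(t)` is weakly divergence free for every `t ∈ (0,T)`
  · refine (ae_restrict_iff' measurableSet_Ioo).2 (ae_of_all _ fun t ht => ?_)
    exact (h.divFree t (hIoo_S ht)).isWeaklyDivFree_holds (hu.isSmooth_slice (hIoo_S ht))
  -- (7) the weak identity with datum
  · intro ψ hψ
    obtain ⟨hψs, T', hT'T, hT'⟩ := id hψ
    rcases le_or_gt T 0 with hT | hT
    · rw [Ioo_eq_empty (not_lt.2 hT), Measure.restrict_empty, integral_zero_measure,
        hT' 0 (hT'T.le.trans hT)]
      simp
    -- the time interval `I = [0, T] ⊆ S` and the pairing `E(t) = ∫ θ(t) ψ(t)`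
    set I : Set ℝ := Icc 0 T with hI_def
    have hIS : I ⊆ S := hS
    have hU : UniqueDiffOn ℝ I := uniqueDiffOn_Icc hT
    have hθI : FunctionSpaces.Torus.IsSmoothSpaceTimeOn I θ := hθ.mono hIS
    have hψI : FunctionSpaces.Torus.IsSmoothSpaceTimeOn I ψ := hψs.contDiffOn
    have hg : FunctionSpaces.Torus.IsSmoothSpaceTimeOn I (fun t x => θ t x * ψ t x) := hθI.mul hψI
    set E : ℝ → ℝ := fun t => ∫ x, θ t x * ψ t x with hE_def
    set E' : ℝ → ℝ := fun t => ∫ x, FunctionSpaces.Torus.timeDerivWithin I (fun t x => θ t x * ψ t x) t x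
      with hE'_def
    have hE : ∀ t ∈ I, HasDerivWithinAt E (E' t) I t := fun t ht =>
      hg.hasDerivWithinAt_integral (convex_Icc 0 T) ht
    have hE'cont : ContinuousOn E' I := hg.continuousOn_integral_timeDerivWithin hU
    -- `∫₀ᵀ E' = E(T) - E(0) = -∫ θ 0 ψ 0`
    have hET : E T = 0 := by
      simp only [hE_def, hT' T hT'T.le, Pi.zero_apply, mul_zero, integral_zero]
    have hFTC : ∫ t in Ioo 0 T, E' t = E T - E 0 := by
      rw [← integral_Ioc_eq_integral_Ioo, ← intervalIntegral.integral_of_le hT.le,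
        intervalIntegral.integral_eq_sub_of_hasDerivAt_of_le hT.le
          (fun t ht => (hE t ht).continuousWithinAt)
          (fun t ht => (hE t (Ioo_subset_Icc_self ht)).hasDerivAt (Icc_mem_nhds ht.1 ht.2))
          ((hE'cont.mono (uIcc_of_le hT.le).subset).intervalIntegrable)]
    -- it suffices to identify the integrand with `E'` on `(0, T)`
    suffices hkey : ∫ t in Ioo 0 T, ∫ x, θ t x *
        (FunctionSpaces.Torus.timeDeriv ψ t x + ⟪u t x, FunctionSpaces.Torus.gradient (ψ t) x⟫_ℝ + κ * FunctionSpaces.Torus.laplacian (ψ t) x) =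
        ∫ t in Ioo 0 T, E' t by
      rw [hkey, hFTC, hET, zero_sub, hE_def, neg_add_cancel]
    refine setIntegral_congr_fun measurableSet_Ioo fun t ht => ?_
    have htS : t ∈ S := hIoo_S ht
    have htI : t ∈ I := Ioo_subset_Icc_self ht
    have hut : FunctionSpaces.Torus.IsSmooth (u t) := hu.isSmooth_slice htS
    have hθt : FunctionSpaces.Torus.IsSmooth (θ t) := hθ.isSmooth_slice htS
    have hψt : FunctionSpaces.Torus.IsSmooth (ψ t) := hψI.isSmooth_slice htI
    have hψ't : FunctionSpaces.Torus.IsSmooth (FunctionSpaces.Torus.timeDeriv ψ t) := hψ.timeDeriv.isSmooth_slice t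
    have hI_nhds : I ∈ 𝓝 t := Icc_mem_nhds ht.1 ht.2
    have hS_nhds : S ∈ 𝓝 t := mem_of_superset hI_nhds hIS
    -- the one-sided time derivatives within `I` and within `S` agree at interior times
    have hAeq : ∀ x, FunctionSpaces.Torus.timeDerivWithin I θ t x = FunctionSpaces.Torus.timeDerivWithin S θ t x := fun x => by
      rw [FunctionSpaces.Torus.timeDerivWithin, FunctionSpaces.Torus.timeDerivWithin, derivWithin_of_mem_nhds hI_nhds,
        derivWithin_of_mem_nhds hS_nhds]
    -- the equation, solved for `∂ₜθ`
    have h3 : ∀ x, FunctionSpaces.Torus.timeDerivWithin S θ t x =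
        κ * FunctionSpaces.Torus.laplacian (θ t) x - ⟪u t x, FunctionSpaces.Torus.gradient (θ t) x⟫_ℝ := fun x => by
      rw [eq_sub_iff_add_eq]
      exact h.transport t htS x
    -- pointwise: `∂ₜ(θψ) = (κΔθ - u·∇θ) ψ + θ ∂ₜψ` on `(0,T)`
    have hslice : ∀ x, FunctionSpaces.Torus.timeDerivWithin I (fun t x => θ t x * ψ t x) t x =
        (κ * FunctionSpaces.Torus.laplacian (θ t) x - ⟪u t x, FunctionSpaces.Torus.gradient (θ t) x⟫_ℝ) * ψ t x +
          θ t x * FunctionSpaces.Torus.timeDeriv ψ t x := by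
      intro x
      have h1 : HasDerivWithinAt (fun τ => θ τ x) (FunctionSpaces.Torus.timeDerivWithin S θ t x) I t := by
        have h' := hθI.hasDerivWithinAt_slice htI x
        rwa [hAeq x] at h'
      have h2 : HasDerivWithinAt (fun τ => ψ τ x) (FunctionSpaces.Torus.timeDeriv ψ t x) I t := by
        obtain ⟨y, rfl⟩ := FunctionSpaces.Torus.proj_surjective x
        have hd : Differentiable ℝ (fun τ : ℝ => FunctionSpaces.Torus.stLift ψ (τ, y)) :=
          (hψs.differentiable (by simp)).comp (differentiable_id.prodMk (differentiable_const y))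
        exact (hd t).hasDerivAt.hasDerivWithinAt
      have h12 := (h1.fun_mul h2).derivWithin (hU t htI)
      rw [FunctionSpaces.Torus.timeDerivWithin, h12, h3]
    -- integrate over the torus and integrate by parts
    -- (`θ x • f x = θ x * f x` on `ℝ`: the smoothness lemmas are stated with `•`)
    have iA : Integrable (fun x => θ t x * FunctionSpaces.Torus.timeDeriv ψ t x) volume := (hθt.smul' hψ't).integrable
    have iB : Integrable (fun x => θ t x * ⟪u t x, FunctionSpaces.Torus.gradient (ψ t) x⟫_ℝ) volume :=
      (hθt.smul' (hut.inner hψt.gradient)).integrable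
    have iB' : Integrable (fun x => ⟪u t x, FunctionSpaces.Torus.gradient (θ t) x⟫_ℝ * ψ t x) volume :=
      ((hut.inner hθt.gradient).smul' hψt).integrable
    have iC : Integrable (fun x => κ * (θ t x * FunctionSpaces.Torus.laplacian (ψ t) x)) volume :=
      (hθt.smul' hψt.laplacian).integrable.const_mul κ
    have iC' : Integrable (fun x => κ * (FunctionSpaces.Torus.laplacian (θ t) x * ψ t x)) volume :=
      (hθt.laplacian.smul' hψt).integrable.const_mul κ
    have iAB : Integrable (fun x => θ t x * FunctionSpaces.Torus.timeDeriv ψ t x +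
        θ t x * ⟪u t x, FunctionSpaces.Torus.gradient (ψ t) x⟫_ℝ) volume := iA.add iB
    have iC'B' : Integrable (fun x => κ * (FunctionSpaces.Torus.laplacian (θ t) x * ψ t x) -
        ⟪u t x, FunctionSpaces.Torus.gradient (θ t) x⟫_ℝ * ψ t x) volume := iC'.sub iB'
    -- the two integrations by parts on the torus
    have hB := integral_mul_inner_gradient_add_eq_zero hut (h.divFree t htS) hθt hψt
    have hC : ∫ x, κ * (θ t x * FunctionSpaces.Torus.laplacian (ψ t) x) = ∫ x, κ * (FunctionSpaces.Torus.laplacian (θ t) x * ψ t x) := by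
      rw [integral_const_mul, integral_const_mul, FunctionSpaces.Torus.integral_mul_laplacian_comm_holds hθt hψt]
    have hL : (fun x => θ t x *
        (FunctionSpaces.Torus.timeDeriv ψ t x + ⟪u t x, FunctionSpaces.Torus.gradient (ψ t) x⟫_ℝ + κ * FunctionSpaces.Torus.laplacian (ψ t) x)) =
        fun x => θ t x * FunctionSpaces.Torus.timeDeriv ψ t x + θ t x * ⟪u t x, FunctionSpaces.Torus.gradient (ψ t) x⟫_ℝ +
          κ * (θ t x * FunctionSpaces.Torus.laplacian (ψ t) x) := funext fun x => by ring
    have hR : (fun x => FunctionSpaces.Torus.timeDerivWithin I (fun t x => θ t x * ψ t x) t x) =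
        fun x => κ * (FunctionSpaces.Torus.laplacian (θ t) x * ψ t x) - ⟪u t x, FunctionSpaces.Torus.gradient (θ t) x⟫_ℝ * ψ t x +
          θ t x * FunctionSpaces.Torus.timeDeriv ψ t x := funext fun x => by rw [hslice x]; ring
    simp only [hE'_def]
    rw [hL, hR, integral_add iAB iC, integral_add iA iB, integral_add iC'B' iA,
      integral_sub iC' iB', hC]
    linarith
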